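import Literature.Barriers.CriticalPhenomena.PlanarEdwardsModelDiffusiveProofs
import Mathlib.Analysis.SpecialFunctions.Stirling
import HarnessLib

/-!
# Asymptotics of the planar return probability: `P[ω(2i) = 0] ∼ 1/(π i)`

Sibling proof file of `Literature.Barriers.CriticalPhenomena.PlanarEdwardsModelDiffusive`. The
sibling `…Proofs` file has the exact formula `P[ω(2i) = 0] = (C(2i,i)/4^i)²`
(`expect_ite_endpoint_eq_zero_eq_sq`, `expect_ite_signSum_eq_zero`: in the coordinates
`x₁ ± x₂` the planar walk is a pair of independent `±1` walks) and the two-sided bounds of order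
`1/i`; here, from Mathlib's Stirling formula (`Stirling.tendsto_stirlingSeq_sqrt_pi`), the sharp
constant — the on-diagonal local central limit theorem at the origin (Lawler 1991, Thm. 1.2.1,
`p_{2i}(0) ∼ 2 · (2/(4π i)) = 1/(π i)` for the planar walk):

* `Literature.Barriers.CriticalPhenomena.Edwards2D.tendsto_centralBinom_mul_sqrt_div` —
  `C(2n,n) √n / 4ⁿ → 1/√π`;
* `Literature.Barriers.CriticalPhenomena.Edwards2D.tendsto_mul_expect_ite_endpoint_eq_zero` —
  `i · P[ω(2i) = 0] → 1/π`.

This is the first local-limit input of the remaining second-moment limits (α₁), (α₂) behind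
`Edwards2D.Stoll1989_invariance_of_secondMomentLimits`.

## References

* G. F. Lawler, *Intersections of Random Walks* (1991), Theorem 1.2.1.
* Mathlib, `Mathlib.Analysis.SpecialFunctions.Stirling`.
-/

noncomputable section

open Finset Filter Topology Stirling
open scoped BigOperators

namespace Literature.Barriers.CriticalPhenomena

namespace Edwards2D

open Literature.Probability.LatticeModels Literature.Probability.Percolation

/-- `C(2n,n) = (s_{2n}/s_n²) · 4ⁿ/√n` in terms of the Stirling sequence `s_n = n!/(√(2n)(n/e)ⁿ)`,
for `n ≥ 1`. [folklore] -/
theorem centralBinom_eq_stirlingSeq {n : ℕ} (hn : n ≠ 0) :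
    (Nat.centralBinom n : ℝ) * Real.sqrt n / 4 ^ n = stirlingSeq (2 * n) / stirlingSeq n ^ 2 := by
  have hn' : (0 : ℝ) < n := by exact_mod_cast Nat.pos_of_ne_zero hn
  have hs : stirlingSeq n ≠ 0 := by
    have := sqrt_pi_le_stirlingSeq hn
    have hπ : 0 < Real.sqrt Real.pi := Real.sqrt_pos.2 Real.pi_pos
    linarith
  -- the factorials in terms of the Stirling sequence
  have hfac : ∀ m : ℕ, 0 < m → (m.factorial : ℝ) =
      stirlingSeq m * (Real.sqrt (2 * m) * ((m : ℝ) / Real.exp 1) ^ m) := by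
    intro m hm
    have hpos : (0 : ℝ) < Real.sqrt (2 * m) * ((m : ℝ) / Real.exp 1) ^ m := by
      have : (0 : ℝ) < m := by exact_mod_cast hm
      positivity
    rw [stirlingSeq, div_mul_cancel₀ _ hpos.ne']
  -- `C(2n,n) (n!)² = (2n)!`
  have hcb : (Nat.centralBinom n : ℝ) * (n.factorial : ℝ) ^ 2 = ((2 * n).factorial : ℝ) := by
    have h := Nat.choose_mul_factorial_mul_factorial (Nat.le_mul_of_pos_left n two_pos)
    rw [show 2 * n - n = n by omega, ← Nat.centralBinom_eq_two_mul_choose] at h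
    have : ((Nat.centralBinom n * n.factorial * n.factorial : ℕ) : ℝ) = ((2 * n).factorial : ℝ) := by
      exact_mod_cast h
    push_cast at this
    linear_combination this
  -- substitute Stirling
  set s1 := stirlingSeq n with hs1
  set s2 := stirlingSeq (2 * n) with hs2
  set A : ℝ := ((n : ℝ) / Real.exp 1) ^ n with hA
  have hn2 : 0 < 2 * n := by omega
  have hfn : (n.factorial : ℝ) = s1 * (Real.sqrt (2 * n) * A) := hfac n (Nat.pos_of_ne_zero hn)
  have hf2n : ((2 * n).factorial : ℝ) = s2 * (Real.sqrt (2 * ((2 * n : ℕ) : ℝ)) *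
      ((((2 * n : ℕ) : ℝ)) / Real.exp 1) ^ (2 * n)) := hfac (2 * n) hn2
  have hsq2n : Real.sqrt (2 * ((2 * n : ℕ) : ℝ)) * Real.sqrt n = 2 * n := by
    push_cast
    rw [← Real.sqrt_mul (by positivity), show 2 * (2 * (n : ℝ)) * n = (2 * n) ^ 2 by ring,
      Real.sqrt_sq (by positivity)]
  have hpow2n : ((((2 * n : ℕ) : ℝ)) / Real.exp 1) ^ (2 * n) = 4 ^ n * A ^ 2 := by
    push_cast
    rw [show (2 * (n : ℝ)) / Real.exp 1 = 2 * ((n : ℝ) / Real.exp 1) by ring, mul_pow, pow_mul,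
      show (2 : ℝ) ^ 2 = 4 by norm_num, hA, ← pow_mul, mul_comm n 2]
  have hsqn : Real.sqrt (2 * n) ^ 2 = 2 * n := Real.sq_sqrt (by positivity)
  -- `C = (2n)!/(n!)²`, so `C √n s1² = s2 4ⁿ ... `
  have hkey : (Nat.centralBinom n : ℝ) * Real.sqrt n * s1 ^ 2 = s2 * 4 ^ n := by
    have hA0 : A ≠ 0 := by rw [hA]; positivity
    have hfn0 : (n.factorial : ℝ) ≠ 0 := by positivity
    -- multiply `hcb` by `√n` and substitute
    have e1 : (Nat.centralBinom n : ℝ) * Real.sqrt n * s1 ^ 2 * ((2 * n) * A ^ 2) =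
        ((Nat.centralBinom n : ℝ) * (n.factorial : ℝ) ^ 2) * Real.sqrt n := by
      rw [hfn]
      have : (s1 * (Real.sqrt (2 * n) * A)) ^ 2 = s1 ^ 2 * (Real.sqrt (2 * n) ^ 2) * A ^ 2 := by ring
      rw [this, hsqn]; ring
    have e2 : ((2 * n).factorial : ℝ) * Real.sqrt n = s2 * 4 ^ n * ((2 * n) * A ^ 2) := by
      rw [hf2n, hpow2n]
      calc s2 * (Real.sqrt (2 * ((2 * n : ℕ) : ℝ)) * (4 ^ n * A ^ 2)) * Real.sqrt n
          = s2 * 4 ^ n * A ^ 2 * (Real.sqrt (2 * ((2 * n : ℕ) : ℝ)) * Real.sqrt n) := by ring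
        _ = s2 * 4 ^ n * ((2 * n) * A ^ 2) := by rw [hsq2n]; ring
    have hne : (2 * (n : ℝ)) * A ^ 2 ≠ 0 := by positivity
    have := e1.trans (by rw [hcb, e2])
    exact mul_right_cancel₀ hne this
  rw [div_eq_div_iff (by positivity) (pow_ne_zero 2 hs)]
  linear_combination hkey

/-- **`C(2n,n) √n / 4ⁿ → 1/√π`** (Stirling). [folklore] -/
theorem tendsto_centralBinom_mul_sqrt_div :
    Tendsto (fun n : ℕ => (Nat.centralBinom n : ℝ) * Real.sqrt n / 4 ^ n) atTop
      (𝓝 (1 / Real.sqrt Real.pi)) := by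
  have h2 : Tendsto (fun n : ℕ => stirlingSeq (2 * n)) atTop (𝓝 (Real.sqrt Real.pi)) :=
    tendsto_stirlingSeq_sqrt_pi.comp (tendsto_id.const_mul_atTop' two_pos)
  have hlim := h2.div (tendsto_stirlingSeq_sqrt_pi.pow 2) (by positivity)
  have hval : Real.sqrt Real.pi / Real.sqrt Real.pi ^ 2 = 1 / Real.sqrt Real.pi := by
    have : Real.sqrt Real.pi ≠ 0 := by positivity
    field_simp
  rw [hval] at hlim
  refine hlim.congr' ?_
  filter_upwards [eventually_ne_atTop 0] with n hn
  exact (centralBinom_eq_stirlingSeq hn).symm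

open Classical in
/-- **The planar return probability is asymptotically `1/(π i)`**: `i · P[ω(2i) = 0] → 1/π`
(`P[ω(2i) = 0] = (C(2i,i)/4^i)²`, and `C(2i,i)√i/4^i → 1/√π`) — the local central limit
theorem of the planar simple random walk on the diagonal, at the origin.
[cite: Lawler1991, Theorem 1.2.1] -/
theorem tendsto_mul_expect_ite_endpoint_eq_zero :
    Tendsto (fun i : ℕ => (i : ℝ) * 𝔼 ω : StepSeq (2 * i), (if endpoint ω = 0 then (1 : ℝ) else 0))
      atTop (𝓝 (1 / Real.pi)) := by
  have hform : ∀ i : ℕ, (i : ℝ) * 𝔼 ω : StepSeq (2 * i), (if endpoint ω = 0 then (1 : ℝ) else 0) =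
      ((Nat.centralBinom i : ℝ) * Real.sqrt i / 4 ^ i) ^ 2 := by
    intro i
    rw [expect_ite_endpoint_eq_zero_eq_sq, expect_ite_signSum_eq_zero, ← Nat.centralBinom_eq_two_mul_choose,
      div_pow, div_pow, mul_pow, Real.sq_sqrt (Nat.cast_nonneg i)]
    ring
  simp_rw [hform]
  have := tendsto_centralBinom_mul_sqrt_div.pow 2
  rw [div_pow, one_pow, Real.sq_sqrt Real.pi_pos.le] at this
  exact this

end Edwards2D

end Literature.Barriers.CriticalPhenomena

end
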